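import Summits.KontsevichZagierPeriods.KontsevichZagierPeriods.Theorems.SoloInformedAlgConeStep
import HarnessLib

/-!
# The DEN-calculus over `K`: the two combinatorial cases of the vertex-germ induction

Solo programme `solo-KontsevichZagierPeriods-informed`, session s107, step (x-m) of the general
two-dimensional algorithm.  With `m = k + 1` the multiplicity of `F` at `0`:

* **the pure-cone step** `soloInformed_vertexGermOK_of_pureCone`: if `cone_F = c (X − θ)^m` with
  `θ ≥ 0` and all child germs of `F` at `θ` have the vertex-germ property, so does `F`
  (normalise `θ ↦ λ₀θ ≤ 1/2`, then the blow-up step with `T₁ = {λ₀θ}`, `T₂ = ∅`);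
* **the mixed-cone step** `soloInformed_vertexGermOK_of_notPure`: if neither `cone_F` nor
  `cone_{swap F}` is a pure `m`-th power with non-negative root and every polynomial of smaller
  multiplicity has the vertex-germ property, so does `F` (all children have multiplicity `< m`);
  here the real roots of polynomials over `K` must lie in `K` (`SoloInformedRealRootClosed`).

References: J. Kollár, *Lectures on Resolution of Singularities* (2007), §1.10;
M. Kontsevich, D. Zagier, *Periods* (2001), §1.2.
-/

noncomputable section

open scoped BigOperators
open MeasureTheory Set Polynomial
open Literature.NumberTheory.Transcendental Literature.NumberTheory.Transcendental.KZ

namespace Summit.KontsevichZagierPeriods.KontsevichZagierPeriods.Theorems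

variable {K : Type*} [Field K] [Algebra K ℝ]

/-! ### The pure-cone step -/

omit [Algebra K ℝ] in
/-- The top coefficient of a pure power. [this work] -/
theorem soloInformed_coeff_C_mul_X_sub_C_pow_self (c a : K) (m : ℕ) :
    (C c * (X - C a) ^ m).coeff m = c := by
  rw [Polynomial.coeff_C_mul, sub_eq_add_neg, ← map_neg C, Polynomial.coeff_X_add_C_pow,
    Nat.sub_self, pow_zero, Nat.choose_self, Nat.cast_one, mul_one, mul_one]

/-- **The pure-cone step.**  If all monomials of `F` have degree `≥ k + 1`, the cone polynomial is
`c (X − θ)^{k+1}` with `c ≠ 0`, `θ ≥ 0`, and all child germs of `F` at `θ` have the vertex-germ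
property, then `F` has the vertex-germ property. [this work] -/
theorem soloInformed_vertexGermOK_of_pureCone (hK : ∀ c : K, IsAlgebraic ℚ (algebraMap K ℝ c))
    {F : MvPolynomial (Fin 2) K} {k : ℕ} (hm : ∀ a ∈ F.support, k + 1 ≤ a 0 + a 1) {c θ : K}
    (hc : c ≠ 0) (hθ : 0 ≤ algebraMap K ℝ θ)
    (hcone : soloInformedConePolyK F (k + 1) = C c * (X - C θ) ^ (k + 1))
    (hchild : ∀ κ lam : K, 0 < algebraMap K ℝ κ → algebraMap K ℝ lam ≠ 0 →
      SoloInformedVertexGermOK (soloInformedChildK F (k + 1) θ κ lam)) :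
    SoloInformedVertexGermOK F := by
  set Θ := algebraMap K ℝ θ with hΘ
  set lam₀ : K := (2 * θ + 2)⁻¹ with hlam₀def
  have hL : algebraMap K ℝ lam₀ = (2 * Θ + 2)⁻¹ := by
    rw [hlam₀def, map_inv₀, map_add, map_mul, map_ofNat]
  have hpos : 0 < 2 * Θ + 2 := by positivity
  have h0 : 0 < algebraMap K ℝ lam₀ := by rw [hL]; exact inv_pos.2 hpos
  have h1 : algebraMap K ℝ lam₀ < 1 := by rw [hL]; exact inv_lt_one_of_one_lt₀ (by linarith)
  have hLΘ : algebraMap K ℝ lam₀ * Θ ≤ 1 / 2 := by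
    rw [hL, ← div_eq_inv_mul, div_le_iff₀ hpos]; linarith
  have hlam₀K : lam₀ ≠ 0 := fun h => h0.ne' (by rw [h, map_zero])
  refine soloInformed_vertexGermOK_of_xScale hK h0 h1 ?_
  have hmL : ∀ a ∈ (soloInformedScaleSubstK 0 0 lam₀ F).support, k + 1 ≤ a 0 + a 1 := by
    rw [soloInformed_support_scaleSubstK_zero 0 hlam₀K]; exact hm
  have hconeL := soloInformed_conePolyK_xScale_of_pow hm hlam₀K hcone
  have hLθ : algebraMap K ℝ (lam₀ * θ) = algebraMap K ℝ lam₀ * Θ := by rw [map_mul]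
  refine soloInformed_vertexGermOK_of_charts hK hmL {algebraMap K ℝ (lam₀ * θ)}
    (fun t ht => ⟨lam₀ * θ, (Finset.mem_singleton.1 ht).symm⟩) (fun t _ _ h => ?_)
    (fun t ht κ lam hκ hlam => ?_) ∅ (fun t ht => by simp at ht) (fun s hs0 hs1 h => ?_)
    (fun t ht => by simp at ht)
  · -- zeros on the exceptional edge
    rw [soloInformed_aeval_edge_blowLowK, soloInformed_aeval_conePolyK_of_pow hconeL, mul_eq_zero,
      pow_eq_zero_iff (Nat.succ_ne_zero k), sub_eq_zero] at h
    rcases h with h | h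
    · exact absurd h ((_root_.map_ne_zero _).2 hc)
    · exact Finset.mem_singleton.2 h
  · -- the children at `λ₀θ`
    have ht' : t = lam₀ * θ := (algebraMap K ℝ).injective (Finset.mem_singleton.1 ht)
    have hlamK : lam ≠ 0 := fun h => hlam (by rw [h, map_zero])
    refine soloInformed_vertexGermOK_congr
      (fun y => (?_ : (MvPolynomial.aeval y (MvPolynomial.C (lam₀ ^ (k + 1)) *
        soloInformedChildK F (k + 1) (lam₀⁻¹ * t) (lam₀ * κ) (lam₀⁻¹ * lam)) : ℝ) = _))
      (soloInformed_vertexGermOK_C_mul ?_)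
    · rw [map_mul, MvPolynomial.aeval_C, map_pow, soloInformed_aeval_childK_xScale F hm h0.ne']
    · rw [ht', inv_mul_cancel_left₀ hlam₀K]
      refine hchild _ _ (by rw [map_mul]; exact mul_pos h0 hκ) ?_
      rw [map_mul, map_inv₀]
      exact mul_ne_zero (inv_ne_zero h0.ne') hlam
  · -- no zeros on the other chart of the exceptional edge
    exfalso
    revert h
    rw [imp_false, soloInformed_aeval_edge_blowLowK]
    by_cases hs : s = 0
    · rw [hs, soloInformed_aeval_zero_conePolyK_swapK _ hmL, hconeL,
        soloInformed_coeff_C_mul_X_sub_C_pow_self]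
      exact (_root_.map_ne_zero _).2 hc
    · rw [soloInformed_aeval_conePolyK_swapK _ hmL hs, soloInformed_aeval_conePolyK_of_pow hconeL,
        hLθ]
      have hs1' : 1 ≤ s⁻¹ := one_le_inv_iff₀.2 ⟨lt_of_le_of_ne hs0 (Ne.symm hs), hs1⟩
      refine mul_ne_zero (pow_ne_zero _ hs) (mul_ne_zero ((_root_.map_ne_zero _).2 hc)
        (pow_ne_zero _ ?_))
      linarith

/-! ### The mixed-cone step -/

/-- **Real-root closedness** of the coefficient field: every real root of a non-zero polynomial
over `K` lies in (the image of) `K` — satisfied by the field of real algebraic numbers.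
[this work] -/
def SoloInformedRealRootClosed (K : Type*) [Field K] [Algebra K ℝ] : Prop :=
  ∀ p : Polynomial K, p ≠ 0 → ∀ z : ℝ, Polynomial.aeval z p = 0 → ∃ c : K, algebraMap K ℝ c = z

/-- The non-negative roots of a cone polynomial that is not a pure power with non-negative root:
they lie in `K`, and the children there have smaller multiplicity. [this work] -/
theorem soloInformed_coneRoots_of_notPure (hKrc : SoloInformedRealRootClosed K)
    {G : MvPolynomial (Fin 2) K} {k : ℕ} (hm : ∀ a ∈ G.support, k + 1 ≤ a 0 + a 1)
    (hne : soloInformedConePolyK G (k + 1) ≠ 0)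
    (hnot : ∀ c t : K, c ≠ 0 → 0 ≤ algebraMap K ℝ t →
      soloInformedConePolyK G (k + 1) ≠ C c * (X - C t) ^ (k + 1))
    (ih : ∀ G' : MvPolynomial (Fin 2) K, soloInformedMultK G' < k + 1 → SoloInformedVertexGermOK G') :
    ∃ T : Finset ℝ, (∀ t ∈ T, ∃ c : K, algebraMap K ℝ c = t) ∧
      (∀ t : ℝ, 0 ≤ t → t ≤ 1 →
        (MvPolynomial.aeval ![0, t] (soloInformedBlowLowK G (k + 1)) : ℝ) = 0 → t ∈ T) ∧
      (∀ t : K, algebraMap K ℝ t ∈ T → ∀ κ lam : K, 0 < algebraMap K ℝ κ →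
        algebraMap K ℝ lam ≠ 0 → SoloInformedVertexGermOK (soloInformedChildK G (k + 1) t κ lam)) := by
  classical
  set p := soloInformedConePolyK G (k + 1) with hpdef
  have hinj : Function.Injective (algebraMap K ℝ) := (algebraMap K ℝ).injective
  refine ⟨((p.map (algebraMap K ℝ)).roots.toFinset).filter (fun t => 0 ≤ t), fun t ht => ?_,
    fun t ht0 _ h => ?_, fun t ht κ lam hκ hlam => ?_⟩
  · rw [Finset.mem_filter, Multiset.mem_toFinset, Polynomial.mem_roots_map_of_injective hinj hne,
      ← Polynomial.aeval_def] at ht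
    exact hKrc p hne t ht.1
  · rw [Finset.mem_filter, Multiset.mem_toFinset, Polynomial.mem_roots_map_of_injective hinj hne,
      ← Polynomial.aeval_def, hpdef, ← soloInformed_aeval_edge_blowLowK]
    exact ⟨h, ht0⟩
  · rw [Finset.mem_filter] at ht
    have hlamK : lam ≠ 0 := fun h => hlam (by rw [h, map_zero])
    refine ih _ (soloInformed_multK_childK_lt_of_not_pow hm hlamK fun c heq => ?_)
    by_cases hc : c = 0
    · exact hne (by rw [hpdef, heq, hc, C_0, zero_mul])
    · exact hnot c t hc ht.2 heq

omit [Algebra K ℝ] in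
/-- A monomial of degree `m` of `F` gives one of `swap F`. [this work] -/
theorem soloInformed_swapK_support_witness {F : MvPolynomial (Fin 2) K} {a : Fin 2 →₀ ℕ}
    (ha : a ∈ F.support) :
    Finsupp.single (0 : Fin 2) (a 1) + Finsupp.single 1 (a 0) ∈ (soloInformedSwapK F).support := by
  rw [MvPolynomial.mem_support_iff, soloInformed_coeff_swapK]
  have h : Finsupp.single (0 : Fin 2) (a 0) + Finsupp.single 1 (a 1) = a := by
    ext j
    fin_cases j
    · exact (soloInformed_single_add_single_apply _ _).1
    · exact (soloInformed_single_add_single_apply _ _).2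
  rw [h]
  exact MvPolynomial.mem_support_iff.1 ha

/-- **The mixed-cone step.**  If `F` has multiplicity exactly `k + 1`, neither `cone_F` nor
`cone_{swap F}` is `c (X − t)^{k+1}` with `c ≠ 0`, `t ≥ 0`, real roots of polynomials over `K` lie
in `K`, and every polynomial of multiplicity `≤ k` has the vertex-germ property, then `F` has the
vertex-germ property. [this work] -/
theorem soloInformed_vertexGermOK_of_notPure (hK : ∀ c : K, IsAlgebraic ℚ (algebraMap K ℝ c))
    (hKrc : SoloInformedRealRootClosed K) {F : MvPolynomial (Fin 2) K} {k : ℕ}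
    (hm : ∀ a ∈ F.support, k + 1 ≤ a 0 + a 1) {a₀ : Fin 2 →₀ ℕ} (ha₀ : a₀ ∈ F.support)
    (hdeg : a₀ 0 + a₀ 1 = k + 1)
    (h₁ : ∀ c t : K, c ≠ 0 → 0 ≤ algebraMap K ℝ t →
      soloInformedConePolyK F (k + 1) ≠ C c * (X - C t) ^ (k + 1))
    (h₂ : ∀ c t : K, c ≠ 0 → 0 ≤ algebraMap K ℝ t →
      soloInformedConePolyK (soloInformedSwapK F) (k + 1) ≠ C c * (X - C t) ^ (k + 1))
    (ih : ∀ G : MvPolynomial (Fin 2) K, soloInformedMultK G < k + 1 → SoloInformedVertexGermOK G) :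
    SoloInformedVertexGermOK F := by
  have hm₂ := soloInformed_le_deg_swapK hm
  obtain ⟨T₁, hT₁K, hT₁, hchild₁⟩ := soloInformed_coneRoots_of_notPure hKrc hm
    (soloInformed_conePolyK_ne_zero F hm ha₀ hdeg) h₁ ih
  obtain ⟨T₂, hT₂K, hT₂, hchild₂⟩ := soloInformed_coneRoots_of_notPure hKrc hm₂
    (soloInformed_conePolyK_ne_zero _ hm₂ (soloInformed_swapK_support_witness ha₀)
      (by rw [(soloInformed_single_add_single_apply _ _).1,
        (soloInformed_single_add_single_apply _ _).2]; omega)) h₂ ih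
  exact soloInformed_vertexGermOK_of_charts hK hm T₁ hT₁K hT₁ hchild₁ T₂ hT₂K hT₂ hchild₂

end Summit.KontsevichZagierPeriods.KontsevichZagierPeriods.Theorems
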